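/-
Copyright (c) 2026 the pub-hodgecm-mathlib formalisation cell (harness21).  Prover seat hodgecm-mathlib-K2E1-p13 (g6), Track B ∕ K2-LIT, h413 = `stmt-HodgeConjecture-24833`,
R90-TF section S8 «ContSpec-n½», S8 dealer R90-CS-plan (g3) S8-R242 «`R90S8ResGMidVanishingResidueOfLettersU3 :: hVEC_of_orthogonality` = hVEC ROAD (A) ASSEMBLY»: the vector half of
MW IV.1.11 at the middle pole for ONE τ-admissible generator datum of record — «all constant-term coefficients have zero residue at `3∕2` ⟹ the residue of the family at `3∕2` vanishes» —
assembled from ★ CT-RES (`R90S8ResidueConstantTermOfExportsU3`), ★ KER (`R90S8ResidueMapKernelU3`) and ★ the pole-letter invariance (`R90S8ResGMidAtomArchStableU3`), hypothesis-first.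
-/
import Summits.HodgeConjecture.HodgeConjecture.Theorems.R90S8ResidueMapKernelU3              -- ★ KER (K2E1-p10): `res_class_eq_zero_iff_rhoPsi_eq_zero`, `toLp_quotFun_mem_cuspidalSubspace_of_borelConstantTerm_eq_zero`; brings ★ CT-RES, `residualSubspace`, `quotFun`
import Summits.HodgeConjecture.HodgeConjecture.Theorems.R90S8ResGMidAtomArchStableU3          -- ★ (K2E1-p11): `midPoleLetter_apply_quotientSubgroup_mul` (left `A_G·G(F)`-invariance of the residue function)
import Summits.HodgeConjecture.HodgeConjecture.Theorems.R90S8ResGMidBlockEqBotOfRecordU3      -- ★ p864870 (this seat): (V♭) OF RECORD heads, `resGMidBlockτ_eq_bot_of_noMiddlePole`; brings ★ τ-DEFS, D1–D3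
import HarnessLib

/-!
# S8 — `R90S8ResGMidVanishingResidueOfLettersU3`: hVEC, ROAD (A) — zero constant-term residue ⟹ zero residue, for a middle-pole generator datum of record

Track B ∕ R90-TF, crux h413 = `stmt-HodgeConjecture-24833`, route of record `HCCMUnconditional`; cell `hodgecm-mathlib`, section S8 «ContSpec-n½», socket B MID ∕ (V♭) :406 (letter
`hVEC` of ★ p864870 `resGMidBlockτ_eq_bot_of_not_lHalfNeZero_of_record`).  THEOREMS ONLY (no `def`, no `instance`, no `notation`, no named-fact hypothesis, no `sorry`; default heartbeats);
lane `--supports stmt-HodgeConjecture-24833 --as helper` (count-neutral).  CLOSES NO SOCKET.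

THE MATHEMATICS ([MoeglinWaldspurger1995] I.2.18, IV.1.9–IV.1.11, V.3.13; [Langlands1976] §7; [Rogawski1990] §13.9 p. 229 (ii)).  Fix a middle-pole generator datum: a pair section `φ`, a
continuation `Ec` of `z ↦ E(φ_z)` carrying ESTATE T's clauses near `z₀ = 3∕2` (co-discrete pole set `P`, analyticity and continuity off `P`, the joint local bound (E2-bd)), its pole letter
`Fp` (`Fp g` analytic at `3∕2`, `= (z − 3∕2)·Ec z g` on a punctured neighbourhood), the ℓ-CT shape `(Ec z)_B g = φ g·H(g)^z + ψ(z,g)·H(g)^{2−z}` near `3∕2`, and the residue CLASS `f ∈ L²`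
(`f =ᵐ x ↦ Fp((out x)⁻¹)(3∕2)`, ★ D1∕T3).  SUPPOSE every constant-term coefficient has ZERO RESIDUE at `3∕2`: `(z − 3∕2)·ψ(z, g) → 0` for every `g` (★ p864870 §3 delivers this from
`¬ LHalfNeZero` + the coordinate factorisation).  Then ★ CT-RES reads `CT(Res)(g) = 0·H(g)^{1∕2} = 0`: the residue function `R := Fp(·)(3∕2)` — continuous (★ `continuous_midPoleLetter_apply`),
left-`A_G·G(F)`-invariant (★ `midPoleLetter_apply_quotientSubgroup_mul`) — has vanishing Borel constant term, so its class lies in `L²_cusp` (★ KER §2); if the class is also ORTHOGONAL to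
`L²_cusp` — either because it lies in `L²_res = L²_disc ⊓ (L²_cusp)ᗮ` (the (R)′ conclusion applied to the generator, ★ KER's `hres`) or by the orthogonality letters of ★
`resGMidAtomGen_inner_cuspidal_eq_zero_of_letters` (K2E4-p14's OF RECORD) — then `⟪f, f⟫ = 0`: **`f = 0`** (§1).  Since `R` is continuous and `μ` charges opens, `R ≡ 0`: **`Fp g (3∕2) = 0` for
every `g`** (§2), and therefore **`(z − 3∕2)·Ec z g → 0`** for every `g` (§2; `Fp g` is continuous at `3∕2` and agrees with `(z−3∕2)·Ec z g` nearby) — the conclusion of ★ p864870's letter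
`hVEC` for this datum.  §3 lifts this to the τ-admissible block: if every τ-admissible generator datum carries T's clauses + the ℓ-CT shape + zero coefficient residues + residual membership,
then `resGMidBlockτ ξ μω = ⊥`.
* §1 **`res_class_eq_zero_of_zero_coeff_residue`** (via `hres`, ★ KER), **`res_class_eq_zero_of_zero_coeff_residue_of_orthogonal`** (via `horth : ∀ u ∈ L²_cusp, ⟪u, f⟫ = 0`, ★ KER §2).
* §2 **`midPoleLetter_apply_eq_zero_of_class_eq_zero`** (`f = 0 ⟹ ∀ g, Fp g (3∕2) = 0`), `tendsto_sub_mul_zero_of_midPoleLetter_eq_zero`, and the HEADS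
  **`hVEC_of_residual`** ∕ **`hVEC_of_orthogonality`**: `∀ g, Tendsto (fun z => (z − 3∕2)·Ec z g) (𝓝[≠] (3∕2)) (𝓝 0)`.
* §3 **`resGMidBlockτ_eq_bot_of_zero_coeff_residues_of_residual`** — block level: T's clauses + ℓ-CT shape + zero coefficient residues for every τ-admissible datum + `resGMidBlockτ ≤ L²_res` ⟹ `⊥`.
VISIBLE LETTERS: T's clauses `P hPdisc hEcA hEcc hE2bd` for the datum's `Ec` (★ for THE exported continuation of a τ-admissible `φ`; for an arbitrary admissible `Ec` via the identity-theorem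
bridge ★ `R90S8ResGMidAtomArchStableU3` §1), the ℓ-CT shape `hCT` (★ `ctPackage_of_scalarRoad` device), `hψ0` (★ p864870 §3 ⇐ `hfacτ` + `¬ LHalfNeZero`), and `hres` ((R)′τ) or `horth`
(K2E4-p14).  HONEST LABEL: HC_CM is proved only modulo the 7 printed citations (2 remaining named inputs: hLiu418 = `stmt-HodgeConjecture-24832`, h413 = `stmt-HodgeConjecture-24833`)
until rung 0 closes; REL ≠ ★ ≠ BUILT; this file asserts no named fact, is conditional by construction on the displayed letters, and closes no socket; count-neutral.

## References
* [MoeglinWaldspurger1995] C. Mœglin, J.-L. Waldspurger, *Spectral Decomposition and Eisenstein Series* (1995), I.2.18, IV.1.9–IV.1.11, V.3.13.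
* [Langlands1976] R. P. Langlands, *On the Functional Equations Satisfied by Eisenstein Series*, LNM 544 (1976), §7.
* [Rogawski1990] J. D. Rogawski, *Automorphic Representations of Unitary Groups in Three Variables* (1990), §2.1, §13.9 p. 229 (ii).
-/

set_option autoImplicit false
set_option linter.dupNamespace false  -- the mandated namespace `…HodgeConjecture.HodgeConjecture.R90.S8` (LEAD #1 L1) repeats the summit's segment

noncomputable section

open MeasureTheory Measure Set Filter Topology NumberField IsDedekindDomain
open scoped ENNReal NNReal Topology
open Literature.NumberTheory.Automorphic Literature.NumberTheory.Automorphic.UnitaryGroup Literature.NumberTheory.GaloisRepresentations AdelicGroupData ContRepresentation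
open Literature.NumberTheory.Automorphic.Arthur2013.Leaves.TECR Literature.NumberTheory.Rogawski1990
open Summit.HodgeConjecture.HodgeConjecture.Cruxes.H413.K2E1BorelEisensteinU
open Summit.HodgeConjecture.HodgeConjecture.Cruxes.H413.K2E1CharacterEisensteinU3PairDefs
open Summit.HodgeConjecture.HodgeConjecture.Cruxes.H413.K2E1ChiSectionSpaceU3PairDefs
open Summit.HodgeConjecture.HodgeConjecture.Cruxes.H413.K2E1CuspidalSpectrumUnitary

namespace Summit.HodgeConjecture.HodgeConjecture.R90.S8

variable (L : Type) [Field L] [NumberField L] [IsCMField L]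
  [MeasurableSpace (quasiSplit (↥(maximalRealSubfield L)) L (IsCMField.complexConj L) 3).Adelic] [BorelSpace (quasiSplit (↥(maximalRealSubfield L)) L (IsCMField.complexConj L) 3).Adelic]
  (μ : Measure (quasiSplit (↥(maximalRealSubfield L)) L (IsCMField.complexConj L) 3).automorphicQuotient)
  [(quasiSplit (↥(maximalRealSubfield L)) L (IsCMField.complexConj L) 3).IsAutomorphicMeasure μ]

/-! ## §1 The residue CLASS vanishes: zero coefficient residues + (residual membership OR orthogonality to `L²_cusp`) -/

/-- **ROAD (A), CLASS LEVEL — `f = 0` from ZERO COEFFICIENT RESIDUES and the (R)′ membership.**  Hypotheses = ★ KER `res_class_eq_zero_iff_rhoPsi_eq_zero`'s binders byte for byte with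
`ρψ := 0`: ESTATE T's clauses near `3∕2` for `Ec` (`hPdisc hEcA hEcc hE2bd`), the pole letter (`hFp hFpE`) and its left invariance (`hinv`), the ℓ-CT shape `hCT` at ONE Heisenberg package
`(ν₀, 𝓕₀)` (compact closure, `0 < ν₀𝓕₀ < ∞`), **`hψ0 : ∀ g, (z − 3∕2)·ψ z g → 0`**, the class `hf`, and `hres : f ∈ L²_res(𝔓)` (every radical of `𝔓` `= N(𝔸)`).  THEN `f = 0`.
[cite: MoeglinWaldspurger1995, I.2.18, IV.1.11, V.3.13] [cite: Langlands1976, §7] -/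
theorem res_class_eq_zero_of_zero_coeff_residue
    (ν₀ : Measure ↥(adelicUnipotent (↥(maximalRealSubfield L)) L (IsCMField.complexConj L) 3)) [ν₀.IsHaarMeasure]
    {𝓕₀ : Set ↥(adelicUnipotent (↥(maximalRealSubfield L)) L (IsCMField.complexConj L) 3)}
    (h𝓕₀ : IsFundamentalDomain ↥(rationalUnipotent (↥(maximalRealSubfield L)) L (IsCMField.complexConj L) 3) 𝓕₀ ν₀) (h𝓕₀c : IsCompact (closure 𝓕₀))
    (h𝓕₀0 : ν₀ 𝓕₀ ≠ 0) (h𝓕₀top : ν₀ 𝓕₀ ≠ ∞)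
    (Ec : ℂ → (quasiSplit (↥(maximalRealSubfield L)) L (IsCMField.complexConj L) 3).Adelic → ℂ) (P : Set ℂ)
    (hPdisc : ∀ᶠ s in 𝓝[≠] ((3 : ℂ) / 2), s ∉ P)
    (hEcA : ∀ g (z : ℂ), z ∉ P → AnalyticAt ℂ (fun z => Ec z g) z)
    (hEcc : ∀ z : ℂ, z ∉ P → Continuous (Ec z))
    (hE2bd : ∀ z₁ : ℂ, z₁ ∉ P → ∀ K : Set (quasiSplit (↥(maximalRealSubfield L)) L (IsCMField.complexConj L) 3).Adelic, IsCompact K →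
      ∃ V ∈ 𝓝 z₁, ∃ M : ℝ, ∀ z ∈ V, ∀ g ∈ K, ‖Ec z g‖ ≤ M)
    (Fp : (quasiSplit (↥(maximalRealSubfield L)) L (IsCMField.complexConj L) 3).Adelic → ℂ → ℂ) (hFp : ∀ g, AnalyticAt ℂ (Fp g) ((3 : ℂ) / 2))
    (hFpE : ∀ g, Fp g =ᶠ[𝓝[≠] ((3 : ℂ) / 2)] fun z => (z - (3 : ℂ) / 2) * Ec z g)
    (hinv : ∀ γ ∈ (quasiSplit (↥(maximalRealSubfield L)) L (IsCMField.complexConj L) 3).quotientSubgroup,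
      ∀ g : (quasiSplit (↥(maximalRealSubfield L)) L (IsCMField.complexConj L) 3).Adelic, Fp (γ * g) ((3 : ℂ) / 2) = Fp g ((3 : ℂ) / 2))
    (φ : (quasiSplit (↥(maximalRealSubfield L)) L (IsCMField.complexConj L) 3).Adelic → ℂ) (ψ : ℂ → (quasiSplit (↥(maximalRealSubfield L)) L (IsCMField.complexConj L) 3).Adelic → ℂ)
    (hCT : ∀ᶠ z in 𝓝[≠] ((3 : ℂ) / 2), ∀ g : (quasiSplit (↥(maximalRealSubfield L)) L (IsCMField.complexConj L) 3).Adelic,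
      borelConstantTerm ν₀ 𝓕₀ (Ec z) g = φ g * (((borelHeight g : ℝ≥0) : ℝ) : ℂ) ^ z + ψ z g * (((borelHeight g : ℝ≥0) : ℝ) : ℂ) ^ (2 - z))
    (hψ0 : ∀ g, Tendsto (fun z : ℂ => (z - (3 : ℂ) / 2) * ψ z g) (𝓝[≠] ((3 : ℂ) / 2)) (𝓝 0))
    (𝔓 : (quasiSplit (↥(maximalRealSubfield L)) L (IsCMField.complexConj L) 3).ParabolicUnipotentData)
    (h𝔓 : ∀ j : 𝔓.ι, 𝔓.radical j = adelicUnipotent (↥(maximalRealSubfield L)) L (IsCMField.complexConj L) 3)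
    {f : (quasiSplit (↥(maximalRealSubfield L)) L (IsCMField.complexConj L) 3).L2 μ}
    (hf : (f : (quasiSplit (↥(maximalRealSubfield L)) L (IsCMField.complexConj L) 3).automorphicQuotient → ℂ) =ᵐ[μ]
      fun x => Fp (Quotient.out (x : (quasiSplit (↥(maximalRealSubfield L)) L (IsCMField.complexConj L) 3).Adelic ⧸
        (quasiSplit (↥(maximalRealSubfield L)) L (IsCMField.complexConj L) 3).quotientSubgroup))⁻¹ ((3 : ℂ) / 2))
    (hres : f ∈ (residualSubspace (quasiSplit (↥(maximalRealSubfield L)) L (IsCMField.complexConj L) 3) μ 𝔓).toSubmodule) :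
    f = 0 :=
  (res_class_eq_zero_iff_rhoPsi_eq_zero L μ ν₀ h𝓕₀ h𝓕₀c h𝓕₀0 h𝓕₀top Ec P hPdisc hEcA hEcc hE2bd Fp hFp hFpE hinv φ ψ (fun _ => 0) hCT hψ0 𝔓 h𝔓 hf hres).2
    fun _ => rfl

/-- **ROAD (A), CLASS LEVEL, ORTHOGONALITY VARIANT — `f = 0` from ZERO COEFFICIENT RESIDUES and `f ⊥ L²_cusp`** (the orthogonality delivered by ★ `resGMidAtomGen_inner_cuspidal_eq_zero_of_letters`,
K2E4-p14's OF RECORD): ★ CT-RES gives `CT(Fp · (3∕2)) = 0`, ★ KER §2 puts the class in `L²_cusp`, and `⟪f, f⟫ = 0`. [cite: MoeglinWaldspurger1995, I.2.18, IV.1.11] [cite: Langlands1976, §7] -/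
theorem res_class_eq_zero_of_zero_coeff_residue_of_orthogonal
    (ν₀ : Measure ↥(adelicUnipotent (↥(maximalRealSubfield L)) L (IsCMField.complexConj L) 3)) [ν₀.IsHaarMeasure]
    {𝓕₀ : Set ↥(adelicUnipotent (↥(maximalRealSubfield L)) L (IsCMField.complexConj L) 3)}
    (h𝓕₀ : IsFundamentalDomain ↥(rationalUnipotent (↥(maximalRealSubfield L)) L (IsCMField.complexConj L) 3) 𝓕₀ ν₀) (h𝓕₀c : IsCompact (closure 𝓕₀))
    (h𝓕₀0 : ν₀ 𝓕₀ ≠ 0) (h𝓕₀top : ν₀ 𝓕₀ ≠ ∞)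
    (Ec : ℂ → (quasiSplit (↥(maximalRealSubfield L)) L (IsCMField.complexConj L) 3).Adelic → ℂ) (P : Set ℂ)
    (hPdisc : ∀ᶠ s in 𝓝[≠] ((3 : ℂ) / 2), s ∉ P)
    (hEcA : ∀ g (z : ℂ), z ∉ P → AnalyticAt ℂ (fun z => Ec z g) z)
    (hEcc : ∀ z : ℂ, z ∉ P → Continuous (Ec z))
    (hE2bd : ∀ z₁ : ℂ, z₁ ∉ P → ∀ K : Set (quasiSplit (↥(maximalRealSubfield L)) L (IsCMField.complexConj L) 3).Adelic, IsCompact K →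
      ∃ V ∈ 𝓝 z₁, ∃ M : ℝ, ∀ z ∈ V, ∀ g ∈ K, ‖Ec z g‖ ≤ M)
    (Fp : (quasiSplit (↥(maximalRealSubfield L)) L (IsCMField.complexConj L) 3).Adelic → ℂ → ℂ) (hFp : ∀ g, AnalyticAt ℂ (Fp g) ((3 : ℂ) / 2))
    (hFpE : ∀ g, Fp g =ᶠ[𝓝[≠] ((3 : ℂ) / 2)] fun z => (z - (3 : ℂ) / 2) * Ec z g)
    (hinv : ∀ γ ∈ (quasiSplit (↥(maximalRealSubfield L)) L (IsCMField.complexConj L) 3).quotientSubgroup,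
      ∀ g : (quasiSplit (↥(maximalRealSubfield L)) L (IsCMField.complexConj L) 3).Adelic, Fp (γ * g) ((3 : ℂ) / 2) = Fp g ((3 : ℂ) / 2))
    (φ : (quasiSplit (↥(maximalRealSubfield L)) L (IsCMField.complexConj L) 3).Adelic → ℂ) (ψ : ℂ → (quasiSplit (↥(maximalRealSubfield L)) L (IsCMField.complexConj L) 3).Adelic → ℂ)
    (hCT : ∀ᶠ z in 𝓝[≠] ((3 : ℂ) / 2), ∀ g : (quasiSplit (↥(maximalRealSubfield L)) L (IsCMField.complexConj L) 3).Adelic,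
      borelConstantTerm ν₀ 𝓕₀ (Ec z) g = φ g * (((borelHeight g : ℝ≥0) : ℝ) : ℂ) ^ z + ψ z g * (((borelHeight g : ℝ≥0) : ℝ) : ℂ) ^ (2 - z))
    (hψ0 : ∀ g, Tendsto (fun z : ℂ => (z - (3 : ℂ) / 2) * ψ z g) (𝓝[≠] ((3 : ℂ) / 2)) (𝓝 0))
    (𝔓 : (quasiSplit (↥(maximalRealSubfield L)) L (IsCMField.complexConj L) 3).ParabolicUnipotentData)
    (h𝔓 : ∀ j : 𝔓.ι, 𝔓.radical j = adelicUnipotent (↥(maximalRealSubfield L)) L (IsCMField.complexConj L) 3)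
    {f : (quasiSplit (↥(maximalRealSubfield L)) L (IsCMField.complexConj L) 3).L2 μ}
    (hf : (f : (quasiSplit (↥(maximalRealSubfield L)) L (IsCMField.complexConj L) 3).automorphicQuotient → ℂ) =ᵐ[μ]
      fun x => Fp (Quotient.out (x : (quasiSplit (↥(maximalRealSubfield L)) L (IsCMField.complexConj L) 3).Adelic ⧸
        (quasiSplit (↥(maximalRealSubfield L)) L (IsCMField.complexConj L) 3).quotientSubgroup))⁻¹ ((3 : ℂ) / 2))
    (horth : ∀ u ∈ ((quasiSplit (↥(maximalRealSubfield L)) L (IsCMField.complexConj L) 3).cuspidalSubspace μ 𝔓).toSubmodule, inner ℂ u f = 0) :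
    f = 0 := by
  haveI : IsFiniteMeasureOnCompacts ν₀ := inferInstance
  -- ★ CT-RES with `ρψ := 0`: the Borel constant term of the residue function vanishes
  have hCTres : ∀ g : (quasiSplit (↥(maximalRealSubfield L)) L (IsCMField.complexConj L) 3).Adelic,
      borelConstantTerm ν₀ 𝓕₀ (fun y => Fp y ((3 : ℂ) / 2)) g = 0 := fun g => by
    rw [borelConstantTerm_midPoleLetter_eq L ν₀ h𝓕₀.nullMeasurableSet h𝓕₀c Ec P hPdisc hEcA hEcc hE2bd Fp hFp hFpE φ ψ (fun _ => 0) hCT hψ0 g, zero_mul]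
  have hΦc : Continuous fun y : (quasiSplit (↥(maximalRealSubfield L)) L (IsCMField.complexConj L) 3).Adelic => Fp y ((3 : ℂ) / 2) :=
    continuous_midPoleLetter_apply L Ec P hPdisc hEcA hEcc hE2bd Fp hFp hFpE
  -- the descent is the a.e. representative of `f`, hence square-integrable; ★ KER §2: the class lies in `L²_cusp`
  have hΦ2 : MemLp ((quasiSplit (↥(maximalRealSubfield L)) L (IsCMField.complexConj L) 3).quotFun
      fun y : (quasiSplit (↥(maximalRealSubfield L)) L (IsCMField.complexConj L) 3).Adelic => Fp y ((3 : ℂ) / 2)) 2 μ := (Lp.memLp f).ae_eq hf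
  have hcusp := toLp_quotFun_mem_cuspidalSubspace_of_borelConstantTerm_eq_zero L μ hΦc hinv hΦ2 ν₀ h𝓕₀ h𝓕₀0 h𝓕₀top hCTres 𝔓 h𝔓
  have htoLp : hΦ2.toLp ((quasiSplit (↥(maximalRealSubfield L)) L (IsCMField.complexConj L) 3).quotFun
      fun y : (quasiSplit (↥(maximalRealSubfield L)) L (IsCMField.complexConj L) 3).Adelic => Fp y ((3 : ℂ) / 2)) = f :=
    Lp.ext ((MemLp.coeFn_toLp hΦ2).trans hf.symm)
  rw [htoLp] at hcusp
  exact inner_self_eq_zero.mp (horth f hcusp)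

/-! ## §2 Pointwise: `f = 0 ⟹ Fp g (3∕2) = 0 ⟹ (z − 3∕2)·Ec z g → 0`; the heads `hVEC_of_residual`, `hVEC_of_orthogonality` -/

omit [MeasurableSpace (quasiSplit (↥(maximalRealSubfield L)) L (IsCMField.complexConj L) 3).Adelic] [BorelSpace (quasiSplit (↥(maximalRealSubfield L)) L (IsCMField.complexConj L) 3).Adelic] in
/-- **A VANISHING RESIDUE CLASS HAS A VANISHING RESIDUE FUNCTION**: the residue function `g ↦ Fp g (3∕2)` is continuous (★ `continuous_midPoleLetter_apply`) and left-invariant, so if its class is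
`0` in `L²(μ)` it vanishes identically (`μ` charges opens: `Continuous.ae_eq_iff_eq`). [cite: MoeglinWaldspurger1995, IV.1.11] -/
theorem midPoleLetter_apply_eq_zero_of_class_eq_zero
    (Ec : ℂ → (quasiSplit (↥(maximalRealSubfield L)) L (IsCMField.complexConj L) 3).Adelic → ℂ) (P : Set ℂ)
    (hPdisc : ∀ᶠ s in 𝓝[≠] ((3 : ℂ) / 2), s ∉ P)
    (hEcA : ∀ g (z : ℂ), z ∉ P → AnalyticAt ℂ (fun z => Ec z g) z)
    (hEcc : ∀ z : ℂ, z ∉ P → Continuous (Ec z))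
    (hE2bd : ∀ z₁ : ℂ, z₁ ∉ P → ∀ K : Set (quasiSplit (↥(maximalRealSubfield L)) L (IsCMField.complexConj L) 3).Adelic, IsCompact K →
      ∃ V ∈ 𝓝 z₁, ∃ M : ℝ, ∀ z ∈ V, ∀ g ∈ K, ‖Ec z g‖ ≤ M)
    (Fp : (quasiSplit (↥(maximalRealSubfield L)) L (IsCMField.complexConj L) 3).Adelic → ℂ → ℂ) (hFp : ∀ g, AnalyticAt ℂ (Fp g) ((3 : ℂ) / 2))
    (hFpE : ∀ g, Fp g =ᶠ[𝓝[≠] ((3 : ℂ) / 2)] fun z => (z - (3 : ℂ) / 2) * Ec z g)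
    (hinv : ∀ γ ∈ (quasiSplit (↥(maximalRealSubfield L)) L (IsCMField.complexConj L) 3).quotientSubgroup,
      ∀ g : (quasiSplit (↥(maximalRealSubfield L)) L (IsCMField.complexConj L) 3).Adelic, Fp (γ * g) ((3 : ℂ) / 2) = Fp g ((3 : ℂ) / 2))
    {f : (quasiSplit (↥(maximalRealSubfield L)) L (IsCMField.complexConj L) 3).L2 μ}
    (hf : (f : (quasiSplit (↥(maximalRealSubfield L)) L (IsCMField.complexConj L) 3).automorphicQuotient → ℂ) =ᵐ[μ]
      fun x => Fp (Quotient.out (x : (quasiSplit (↥(maximalRealSubfield L)) L (IsCMField.complexConj L) 3).Adelic ⧸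
        (quasiSplit (↥(maximalRealSubfield L)) L (IsCMField.complexConj L) 3).quotientSubgroup))⁻¹ ((3 : ℂ) / 2))
    (hf0 : f = 0) : ∀ g : (quasiSplit (↥(maximalRealSubfield L)) L (IsCMField.complexConj L) 3).Adelic, Fp g ((3 : ℂ) / 2) = 0 := by
  have hΦc : Continuous fun y : (quasiSplit (↥(maximalRealSubfield L)) L (IsCMField.complexConj L) 3).Adelic => Fp y ((3 : ℂ) / 2) :=
    continuous_midPoleLetter_apply L Ec P hPdisc hEcA hEcc hE2bd Fp hFp hFpE
  have hae : (quasiSplit (↥(maximalRealSubfield L)) L (IsCMField.complexConj L) 3).quotFun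
      (fun y : (quasiSplit (↥(maximalRealSubfield L)) L (IsCMField.complexConj L) 3).Adelic => Fp y ((3 : ℂ) / 2)) =ᵐ[μ] (fun _ => (0 : ℂ)) := by
    have h1 : ((f : (quasiSplit (↥(maximalRealSubfield L)) L (IsCMField.complexConj L) 3).L2 μ) :
        (quasiSplit (↥(maximalRealSubfield L)) L (IsCMField.complexConj L) 3).automorphicQuotient → ℂ) =ᵐ[μ] (fun _ => (0 : ℂ)) := by
      rw [hf0]
      exact Lp.coeFn_zero _ _ _
    exact hf.symm.trans h1
  have hzero : (quasiSplit (↥(maximalRealSubfield L)) L (IsCMField.complexConj L) 3).quotFun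
      (fun y : (quasiSplit (↥(maximalRealSubfield L)) L (IsCMField.complexConj L) 3).Adelic => Fp y ((3 : ℂ) / 2)) = fun _ => (0 : ℂ) :=
    (Continuous.ae_eq_iff_eq μ (AdelicGroupData.continuous_quotFun hinv hΦc) continuous_const).1 hae
  intro y
  have h := congrFun hzero ((quasiSplit (↥(maximalRealSubfield L)) L (IsCMField.complexConj L) 3).toAutomorphicQuotient y⁻¹)
  rw [AdelicGroupData.quotFun_toAutomorphicQuotient hinv, inv_inv] at h
  exact h

omit [MeasurableSpace (quasiSplit (↥(maximalRealSubfield L)) L (IsCMField.complexConj L) 3).Adelic] [BorelSpace (quasiSplit (↥(maximalRealSubfield L)) L (IsCMField.complexConj L) 3).Adelic]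
  [(quasiSplit (↥(maximalRealSubfield L)) L (IsCMField.complexConj L) 3).IsAutomorphicMeasure μ] in
/-- **A vanishing pole letter kills the residue limit**: `Fp g (3∕2) = 0`, `Fp g` analytic at `3∕2` and `= (z − 3∕2)·Ec z g` nearby ⟹ `(z − 3∕2)·Ec z g → 0` on `𝓝[≠] (3∕2)`. [cite: MoeglinWaldspurger1995, IV.1.11] -/
theorem tendsto_sub_mul_zero_of_midPoleLetter_eq_zero
    {Ec : ℂ → (quasiSplit (↥(maximalRealSubfield L)) L (IsCMField.complexConj L) 3).Adelic → ℂ}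
    {Fp : (quasiSplit (↥(maximalRealSubfield L)) L (IsCMField.complexConj L) 3).Adelic → ℂ → ℂ} (hFp : ∀ g, AnalyticAt ℂ (Fp g) ((3 : ℂ) / 2))
    (hFpE : ∀ g, Fp g =ᶠ[𝓝[≠] ((3 : ℂ) / 2)] fun z => (z - (3 : ℂ) / 2) * Ec z g)
    (h0 : ∀ g, Fp g ((3 : ℂ) / 2) = 0) (g : (quasiSplit (↥(maximalRealSubfield L)) L (IsCMField.complexConj L) 3).Adelic) :
    Tendsto (fun z => (z - (3 : ℂ) / 2) * Ec z g) (𝓝[≠] ((3 : ℂ) / 2)) (𝓝 0) := by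
  have h := ((hFp g).continuousAt.tendsto.mono_left nhdsWithin_le_nhds).congr' (hFpE g)
  rwa [h0 g] at h

/-- **HEAD `hVEC_of_residual` — MW IV.1.11, VECTOR HALF, ROAD (A), FOR ONE GENERATOR DATUM OF RECORD**: under ESTATE T's clauses for `Ec` near `3∕2`, the pole letter `(Fp, hFp, hFpE)` with its
left invariance, the ℓ-CT shape `hCT` at one Heisenberg package, the residue class `hf` lying in `L²_res(𝔓)` ((R)′), and **ZERO COEFFICIENT RESIDUES `hψ0`**:
`∀ g, (z − 3∕2)·Ec z g → 0` — the conclusion of ★ p864870's letter `hVEC` for this datum. [cite: MoeglinWaldspurger1995, IV.1.11, V.3.13] [cite: Langlands1976, §7] [cite: Rogawski1990, §13.9 p. 229 (ii)] -/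
theorem hVEC_of_residual
    (ν₀ : Measure ↥(adelicUnipotent (↥(maximalRealSubfield L)) L (IsCMField.complexConj L) 3)) [ν₀.IsHaarMeasure]
    {𝓕₀ : Set ↥(adelicUnipotent (↥(maximalRealSubfield L)) L (IsCMField.complexConj L) 3)}
    (h𝓕₀ : IsFundamentalDomain ↥(rationalUnipotent (↥(maximalRealSubfield L)) L (IsCMField.complexConj L) 3) 𝓕₀ ν₀) (h𝓕₀c : IsCompact (closure 𝓕₀))
    (h𝓕₀0 : ν₀ 𝓕₀ ≠ 0) (h𝓕₀top : ν₀ 𝓕₀ ≠ ∞)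
    (Ec : ℂ → (quasiSplit (↥(maximalRealSubfield L)) L (IsCMField.complexConj L) 3).Adelic → ℂ) (P : Set ℂ)
    (hPdisc : ∀ᶠ s in 𝓝[≠] ((3 : ℂ) / 2), s ∉ P)
    (hEcA : ∀ g (z : ℂ), z ∉ P → AnalyticAt ℂ (fun z => Ec z g) z)
    (hEcc : ∀ z : ℂ, z ∉ P → Continuous (Ec z))
    (hE2bd : ∀ z₁ : ℂ, z₁ ∉ P → ∀ K : Set (quasiSplit (↥(maximalRealSubfield L)) L (IsCMField.complexConj L) 3).Adelic, IsCompact K →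
      ∃ V ∈ 𝓝 z₁, ∃ M : ℝ, ∀ z ∈ V, ∀ g ∈ K, ‖Ec z g‖ ≤ M)
    (Fp : (quasiSplit (↥(maximalRealSubfield L)) L (IsCMField.complexConj L) 3).Adelic → ℂ → ℂ) (hFp : ∀ g, AnalyticAt ℂ (Fp g) ((3 : ℂ) / 2))
    (hFpE : ∀ g, Fp g =ᶠ[𝓝[≠] ((3 : ℂ) / 2)] fun z => (z - (3 : ℂ) / 2) * Ec z g)
    (hinv : ∀ γ ∈ (quasiSplit (↥(maximalRealSubfield L)) L (IsCMField.complexConj L) 3).quotientSubgroup,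
      ∀ g : (quasiSplit (↥(maximalRealSubfield L)) L (IsCMField.complexConj L) 3).Adelic, Fp (γ * g) ((3 : ℂ) / 2) = Fp g ((3 : ℂ) / 2))
    (φ : (quasiSplit (↥(maximalRealSubfield L)) L (IsCMField.complexConj L) 3).Adelic → ℂ) (ψ : ℂ → (quasiSplit (↥(maximalRealSubfield L)) L (IsCMField.complexConj L) 3).Adelic → ℂ)
    (hCT : ∀ᶠ z in 𝓝[≠] ((3 : ℂ) / 2), ∀ g : (quasiSplit (↥(maximalRealSubfield L)) L (IsCMField.complexConj L) 3).Adelic,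
      borelConstantTerm ν₀ 𝓕₀ (Ec z) g = φ g * (((borelHeight g : ℝ≥0) : ℝ) : ℂ) ^ z + ψ z g * (((borelHeight g : ℝ≥0) : ℝ) : ℂ) ^ (2 - z))
    (hψ0 : ∀ g, Tendsto (fun z : ℂ => (z - (3 : ℂ) / 2) * ψ z g) (𝓝[≠] ((3 : ℂ) / 2)) (𝓝 0))
    (𝔓 : (quasiSplit (↥(maximalRealSubfield L)) L (IsCMField.complexConj L) 3).ParabolicUnipotentData)
    (h𝔓 : ∀ j : 𝔓.ι, 𝔓.radical j = adelicUnipotent (↥(maximalRealSubfield L)) L (IsCMField.complexConj L) 3)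
    {f : (quasiSplit (↥(maximalRealSubfield L)) L (IsCMField.complexConj L) 3).L2 μ}
    (hf : (f : (quasiSplit (↥(maximalRealSubfield L)) L (IsCMField.complexConj L) 3).automorphicQuotient → ℂ) =ᵐ[μ]
      fun x => Fp (Quotient.out (x : (quasiSplit (↥(maximalRealSubfield L)) L (IsCMField.complexConj L) 3).Adelic ⧸
        (quasiSplit (↥(maximalRealSubfield L)) L (IsCMField.complexConj L) 3).quotientSubgroup))⁻¹ ((3 : ℂ) / 2))
    (hres : f ∈ (residualSubspace (quasiSplit (↥(maximalRealSubfield L)) L (IsCMField.complexConj L) 3) μ 𝔓).toSubmodule) :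
    ∀ g : (quasiSplit (↥(maximalRealSubfield L)) L (IsCMField.complexConj L) 3).Adelic, Tendsto (fun z => (z - (3 : ℂ) / 2) * Ec z g) (𝓝[≠] ((3 : ℂ) / 2)) (𝓝 0) :=
  tendsto_sub_mul_zero_of_midPoleLetter_eq_zero L hFp hFpE
    (midPoleLetter_apply_eq_zero_of_class_eq_zero L μ Ec P hPdisc hEcA hEcc hE2bd Fp hFp hFpE hinv hf
      (res_class_eq_zero_of_zero_coeff_residue L μ ν₀ h𝓕₀ h𝓕₀c h𝓕₀0 h𝓕₀top Ec P hPdisc hEcA hEcc hE2bd Fp hFp hFpE hinv φ ψ hCT hψ0 𝔓 h𝔓 hf hres))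

/-- **HEAD `hVEC_of_orthogonality` — the same with `horth : f ⊥ L²_cusp` in place of `hres`** (orthogonality = ★ `resGMidAtomGen_inner_cuspidal_eq_zero_of_letters`, paid OF RECORD by K2E4-p14).
[cite: MoeglinWaldspurger1995, IV.1.11, V.3.13] [cite: Langlands1976, §7] -/
theorem hVEC_of_orthogonality
    (ν₀ : Measure ↥(adelicUnipotent (↥(maximalRealSubfield L)) L (IsCMField.complexConj L) 3)) [ν₀.IsHaarMeasure]
    {𝓕₀ : Set ↥(adelicUnipotent (↥(maximalRealSubfield L)) L (IsCMField.complexConj L) 3)}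
    (h𝓕₀ : IsFundamentalDomain ↥(rationalUnipotent (↥(maximalRealSubfield L)) L (IsCMField.complexConj L) 3) 𝓕₀ ν₀) (h𝓕₀c : IsCompact (closure 𝓕₀))
    (h𝓕₀0 : ν₀ 𝓕₀ ≠ 0) (h𝓕₀top : ν₀ 𝓕₀ ≠ ∞)
    (Ec : ℂ → (quasiSplit (↥(maximalRealSubfield L)) L (IsCMField.complexConj L) 3).Adelic → ℂ) (P : Set ℂ)
    (hPdisc : ∀ᶠ s in 𝓝[≠] ((3 : ℂ) / 2), s ∉ P)
    (hEcA : ∀ g (z : ℂ), z ∉ P → AnalyticAt ℂ (fun z => Ec z g) z)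
    (hEcc : ∀ z : ℂ, z ∉ P → Continuous (Ec z))
    (hE2bd : ∀ z₁ : ℂ, z₁ ∉ P → ∀ K : Set (quasiSplit (↥(maximalRealSubfield L)) L (IsCMField.complexConj L) 3).Adelic, IsCompact K →
      ∃ V ∈ 𝓝 z₁, ∃ M : ℝ, ∀ z ∈ V, ∀ g ∈ K, ‖Ec z g‖ ≤ M)
    (Fp : (quasiSplit (↥(maximalRealSubfield L)) L (IsCMField.complexConj L) 3).Adelic → ℂ → ℂ) (hFp : ∀ g, AnalyticAt ℂ (Fp g) ((3 : ℂ) / 2))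
    (hFpE : ∀ g, Fp g =ᶠ[𝓝[≠] ((3 : ℂ) / 2)] fun z => (z - (3 : ℂ) / 2) * Ec z g)
    (hinv : ∀ γ ∈ (quasiSplit (↥(maximalRealSubfield L)) L (IsCMField.complexConj L) 3).quotientSubgroup,
      ∀ g : (quasiSplit (↥(maximalRealSubfield L)) L (IsCMField.complexConj L) 3).Adelic, Fp (γ * g) ((3 : ℂ) / 2) = Fp g ((3 : ℂ) / 2))
    (φ : (quasiSplit (↥(maximalRealSubfield L)) L (IsCMField.complexConj L) 3).Adelic → ℂ) (ψ : ℂ → (quasiSplit (↥(maximalRealSubfield L)) L (IsCMField.complexConj L) 3).Adelic → ℂ)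
    (hCT : ∀ᶠ z in 𝓝[≠] ((3 : ℂ) / 2), ∀ g : (quasiSplit (↥(maximalRealSubfield L)) L (IsCMField.complexConj L) 3).Adelic,
      borelConstantTerm ν₀ 𝓕₀ (Ec z) g = φ g * (((borelHeight g : ℝ≥0) : ℝ) : ℂ) ^ z + ψ z g * (((borelHeight g : ℝ≥0) : ℝ) : ℂ) ^ (2 - z))
    (hψ0 : ∀ g, Tendsto (fun z : ℂ => (z - (3 : ℂ) / 2) * ψ z g) (𝓝[≠] ((3 : ℂ) / 2)) (𝓝 0))
    (𝔓 : (quasiSplit (↥(maximalRealSubfield L)) L (IsCMField.complexConj L) 3).ParabolicUnipotentData)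
    (h𝔓 : ∀ j : 𝔓.ι, 𝔓.radical j = adelicUnipotent (↥(maximalRealSubfield L)) L (IsCMField.complexConj L) 3)
    {f : (quasiSplit (↥(maximalRealSubfield L)) L (IsCMField.complexConj L) 3).L2 μ}
    (hf : (f : (quasiSplit (↥(maximalRealSubfield L)) L (IsCMField.complexConj L) 3).automorphicQuotient → ℂ) =ᵐ[μ]
      fun x => Fp (Quotient.out (x : (quasiSplit (↥(maximalRealSubfield L)) L (IsCMField.complexConj L) 3).Adelic ⧸
        (quasiSplit (↥(maximalRealSubfield L)) L (IsCMField.complexConj L) 3).quotientSubgroup))⁻¹ ((3 : ℂ) / 2))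
    (horth : ∀ u ∈ ((quasiSplit (↥(maximalRealSubfield L)) L (IsCMField.complexConj L) 3).cuspidalSubspace μ 𝔓).toSubmodule, inner ℂ u f = 0) :
    ∀ g : (quasiSplit (↥(maximalRealSubfield L)) L (IsCMField.complexConj L) 3).Adelic, Tendsto (fun z => (z - (3 : ℂ) / 2) * Ec z g) (𝓝[≠] ((3 : ℂ) / 2)) (𝓝 0) :=
  tendsto_sub_mul_zero_of_midPoleLetter_eq_zero L hFp hFpE
    (midPoleLetter_apply_eq_zero_of_class_eq_zero L μ Ec P hPdisc hEcA hEcc hE2bd Fp hFp hFpE hinv hf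
      (res_class_eq_zero_of_zero_coeff_residue_of_orthogonal L μ ν₀ h𝓕₀ h𝓕₀c h𝓕₀0 h𝓕₀top Ec P hPdisc hEcA hEcc hE2bd Fp hFp hFpE hinv φ ψ hCT hψ0 𝔓 h𝔓 hf horth))

/-! ## §3 Block level: the τ-admissible middle block is `⊥` from zero coefficient residues of every τ-admissible generator datum of record -/

/-- **`resGMidBlockτ ξ μω = ⊥` ON ROAD (A)**: if EVERY τ-admissible generator datum `(φ, Ec, Sp, Fp)` (★ T3's clauses) carries ESTATE T's clauses near `3∕2`, the ℓ-CT shape at the package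
`(ν₀, 𝓕₀)` and ZERO COEFFICIENT RESIDUES (letter `hdat` — ★ p864870 §2–§3 give the residues from `¬ LHalfNeZero` + `hfacτ`; the T-clauses come with THE exported continuation), and the
τ-admissible block lies in `L²_res(𝔓)` ((R)′τ, letter `hRes`), then every generator class vanishes (§1, left invariance by ★ `midPoleLetter_apply_quotientSubgroup_mul`), so the block is `⊥`.
[cite: MoeglinWaldspurger1995, IV.1.11, V.3.13] [cite: Langlands1976, §7] [cite: Rogawski1990, §13.9 p. 229 (ii)] -/
theorem resGMidBlockτ_eq_bot_of_zero_coeff_residues_of_residual (ξ : OneDimAutRepH L) (μω : HeckeCharacter L)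
    (ν₀ : Measure ↥(adelicUnipotent (↥(maximalRealSubfield L)) L (IsCMField.complexConj L) 3)) [ν₀.IsHaarMeasure]
    {𝓕₀ : Set ↥(adelicUnipotent (↥(maximalRealSubfield L)) L (IsCMField.complexConj L) 3)}
    (h𝓕₀ : IsFundamentalDomain ↥(rationalUnipotent (↥(maximalRealSubfield L)) L (IsCMField.complexConj L) 3) 𝓕₀ ν₀) (h𝓕₀c : IsCompact (closure 𝓕₀))
    (h𝓕₀0 : ν₀ 𝓕₀ ≠ 0) (h𝓕₀top : ν₀ 𝓕₀ ≠ ∞)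
    (𝔓 : (quasiSplit (↥(maximalRealSubfield L)) L (IsCMField.complexConj L) 3).ParabolicUnipotentData)
    (h𝔓 : ∀ j : 𝔓.ι, 𝔓.radical j = adelicUnipotent (↥(maximalRealSubfield L)) L (IsCMField.complexConj L) 3)
    -- (R)′τ: the τ-admissible middle block is residual
    (hRes : (resGMidBlockτ L μ ξ μω).toSubmodule ≤ (residualSubspace (quasiSplit (↥(maximalRealSubfield L)) L (IsCMField.complexConj L) 3) μ 𝔓).toSubmodule)
    -- per τ-admissible generator datum: T's clauses for `Ec` near `3∕2`, the ℓ-CT shape, and zero coefficient residues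
    (hdat : ∀ U₀ : Subgroup ↥(finAdelic (↥(maximalRealSubfield L)) L (IsCMField.complexConj L) 3 ((StdForm.antidiagonal 3).over L)), IsTauLevel L U₀ →
      ∀ φ ∈ chiSectionSpacePair (ξ.bcη⁻¹ * ξ.bcψ⁻¹ * μω) ξ.ψ (tauLevel L U₀) ((1 : ↥(tauLevel L U₀) →* ℂ) : ↥(tauLevel L U₀) → ℂ), Continuous φ → IsArchFinite L φ →
        ∀ (Ec : ℂ → (quasiSplit (↥(maximalRealSubfield L)) L (IsCMField.complexConj L) 3).Adelic → ℂ) (Sp : Finset ℂ), (∀ s ∈ Sp, s.im = 0 ∧ 1 < s.re ∧ s.re ≤ 2) →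
          (∀ g, DifferentiableOn ℂ (fun z => Ec z g) ({z : ℂ | 1 < z.re} \ (↑Sp : Set ℂ))) → (∀ z : ℂ, 2 < z.re → Ec z = eisensteinSeriesU (flatSectionU φ z)) →
            ∃ (P : Set ℂ) (ψ : ℂ → (quasiSplit (↥(maximalRealSubfield L)) L (IsCMField.complexConj L) 3).Adelic → ℂ),
              (∀ᶠ s in 𝓝[≠] ((3 : ℂ) / 2), s ∉ P) ∧ (∀ g (z : ℂ), z ∉ P → AnalyticAt ℂ (fun z => Ec z g) z) ∧ (∀ z : ℂ, z ∉ P → Continuous (Ec z)) ∧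
              (∀ z₁ : ℂ, z₁ ∉ P → ∀ K : Set (quasiSplit (↥(maximalRealSubfield L)) L (IsCMField.complexConj L) 3).Adelic, IsCompact K →
                ∃ V ∈ 𝓝 z₁, ∃ M : ℝ, ∀ z ∈ V, ∀ g ∈ K, ‖Ec z g‖ ≤ M) ∧
              (∀ᶠ z in 𝓝[≠] ((3 : ℂ) / 2), ∀ g : (quasiSplit (↥(maximalRealSubfield L)) L (IsCMField.complexConj L) 3).Adelic,
                borelConstantTerm ν₀ 𝓕₀ (Ec z) g = φ g * (((borelHeight g : ℝ≥0) : ℝ) : ℂ) ^ z + ψ z g * (((borelHeight g : ℝ≥0) : ℝ) : ℂ) ^ (2 - z)) ∧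
              ∀ g, Tendsto (fun z : ℂ => (z - (3 : ℂ) / 2) * ψ z g) (𝓝[≠] ((3 : ℂ) / 2)) (𝓝 0)) :
    resGMidBlockτ L μ ξ μω = ⊥ := by
  refine le_bot_iff.1 (resGMidBlockτ_le L μ ξ μω ⊥ fun U₀ hU₀ => ?_)
  -- every τ-admissible generator class at the level `U₀` vanishes
  have hgen : resGMidAtomGenτ L μ ξ μω U₀ ⊆ {0} := by
    rintro f ⟨φ, hφ, hφc, hφa, Ec, Sp, hSp, hhol, hEis, Fp, hFp, hFpE, hf⟩
    obtain ⟨P, ψ, hPdisc, hEcA, hEcc, hE2bd, hCT, hψ0⟩ := hdat U₀ hU₀ φ hφ hφc hφa Ec Sp hSp hhol hEis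
    have hinv := midPoleLetter_apply_quotientSubgroup_mul L (isChiSectionPair_of_mem hφ) ξ.hψ (fun s hs => (hSp s hs).1) hhol hEis
      (z₀ := (3 : ℂ) / 2) (by norm_num) (by norm_num) hFp hFpE
    have hfres : f ∈ (residualSubspace (quasiSplit (↥(maximalRealSubfield L)) L (IsCMField.complexConj L) 3) μ 𝔓).toSubmodule :=
      hRes (resGMidAtomτ_le_resGMidBlockτ L μ ξ μω hU₀ (subset_resGMidAtomτ L μ ξ μω U₀ ⟨φ, hφ, hφc, hφa, Ec, Sp, hSp, hhol, hEis, Fp, hFp, hFpE, hf⟩))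
    exact Set.mem_singleton_iff.2
      (res_class_eq_zero_of_zero_coeff_residue L μ ν₀ h𝓕₀ h𝓕₀c h𝓕₀0 h𝓕₀top Ec P hPdisc hEcA hEcc hE2bd Fp hFp hFpE hinv φ ψ hCT hψ0 𝔓 h𝔓 hf hfres)
  have hspan : Submodule.span ℂ (resGMidAtomGenτ L μ ξ μω U₀) = ⊥ :=
    Submodule.span_eq_bot.2 fun f hf => Set.mem_singleton_iff.1 (hgen hf)
  have hcl : IsClosed ((⊥ : Submodule ℂ ((quasiSplit (↥(maximalRealSubfield L)) L (IsCMField.complexConj L) 3).L2 μ)) : Set ((quasiSplit (↥(maximalRealSubfield L)) L (IsCMField.complexConj L) 3).L2 μ)) := by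
    rw [Submodule.bot_coe]; exact isClosed_singleton
  rw [resGMidAtomτ_def, hspan, hcl.submodule_topologicalClosure_eq, ClosedSubrep.toSubmodule_bot]

end Summit.HodgeConjecture.HodgeConjecture.R90.S8

end
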